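import Mathlib
import Summits.AtomisticToContinuum.Crystallization.Theses.PricedLinkCensus
import Literature.Geometry.DiscreteGeometry.BondGraph
import Literature.MathematicalPhysics.StatisticalMechanics.BarlowStacking

/-!
# Route PricedLinkCensus — line Sketch (priced hcp windows) for `StackingHinge`
(stmt-AtomisticToContinuum-14993): soft layer propagation for LOCALLY FINITE configurations
(stub `stub_softLayerPropagationLF`)

The route's crux `SoftLayerPropagation` is stated for finite, `Fin N`-indexed configurations.  To
run it at a point of the infinite point set of a periodic configuration one needs it for a
configuration `y : ι → ℝ³` with an ARBITRARY index type that is locally finite about the site `i`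
(every ball about `y i` holds finitely many sites).  This is a pure locality / truncation
statement:

* along an injection `f : κ → ι` the sub-configuration `y ∘ f` has the same own scale at `m` as
  `y` at `f m` as soon as a `y`-nearest neighbour of `f m` is in the range of `f`
  (`nearestDist_comp_eq_of_injective`); given scale agreement at both endpoints, bonds agree
  (`adj_comp_iff`), hence neighbour sets are preimages (`neighborSet_comp_eq`), ring numbers agree
  (`ringNumber_comp_eq`) and charge-freeness agrees (`isChargeFree_comp_iff`);
* in a locally finite configuration own scales are attained (`exists_nearestDist_eq_dist_of_finite`),
  and the minimiser of a site `j` lies within `2·dist (y i) (y j) + nn_i` of `y i`; so if the range of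
  `f` contains the `R`-ball about `y i`, scales agree at every `f m` with
  `2·dist (y i) (y (f m)) + nn_i ≤ R` (`nearestDist_comp_eq_of_cover`);
* with `R = 100·nn_i`: scales agree within `49·nn_i`, bonds and neighbour sets within `20·nn_i`,
  charges within `8·nn_i`; enumerate the (finite) `100·nn_i`-ball by `Fin M`, apply
  `SoftLayerPropagation` (`η = 1/100`) to `y ∘ f` at `i`, and transfer the two matching clauses back
  (the sites of `y` within `3·nn_i` of `y i` are in the range of `f`).

No positivity of `nn_i` and no injectivity of `y` is needed: the only input is that `i` has
another site, which follows from the charge-freeness of `i` itself (twelve bonds).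

All `[folklore]`; bookkeeping over `BondGraph.lean` (pattern of
`ChargedEnergyGapNegative.isChargeFree_toPoint_iff` and
`PricedHcpWindowsPeriodicTransfer.isChargeFree_periodise_iff`).
-/

namespace Summit.AtomisticToContinuum.Crystallization.Theorems.PricedHcpWindowsLocallyFinite

open Literature.MathematicalPhysics.StatisticalMechanics
open Literature.Geometry.DiscreteGeometry

section Locality

variable {ι κ X : Type*} [PseudoMetricSpace X]

/-! ### Locally finite configurations: attained scales -/

/-- Local finiteness about one site gives local finiteness about every site. [folklore] -/
theorem finite_ball_of_finite_ball {y : ι → X} {i : ι}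
    (hfin : ∀ r : ℝ, {k | dist (y i) (y k) ≤ r}.Finite) (j : ι) (r : ℝ) :
    {k | dist (y j) (y k) ≤ r}.Finite :=
  (hfin (dist (y i) (y j) + r)).subset fun k hk => by
    simp only [Set.mem_setOf_eq] at hk ⊢
    calc dist (y i) (y k) ≤ dist (y i) (y j) + dist (y j) (y k) := dist_triangle _ _ _
      _ ≤ dist (y i) (y j) + r := by linarith

/-- In a configuration that is locally finite about the site `j`, the own nearest-neighbour
distance of `j` is attained (if there is another site). [folklore] -/
theorem exists_nearestDist_eq_dist_of_finite {y : ι → X} {j : ι}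
    (hfin : ∀ r : ℝ, {k | dist (y j) (y k) ≤ r}.Finite) (hj : ∃ k, k ≠ j) :
    ∃ k, k ≠ j ∧ nearestDist y j = dist (y j) (y k) := by
  obtain ⟨k₁, hk₁⟩ := hj
  have hS : ({k | k ≠ j ∧ dist (y j) (y k) ≤ dist (y j) (y k₁)} : Set ι).Finite :=
    (hfin (dist (y j) (y k₁))).subset fun k hk => hk.2
  obtain ⟨k₀, ⟨hk₀j, hk₀d⟩, hmin⟩ :=
    Set.exists_min_image _ (fun k => dist (y j) (y k)) hS ⟨k₁, hk₁, le_rfl⟩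
  refine ⟨k₀, hk₀j, le_antisymm (nearestDist_le_dist y hk₀j)
    (le_nearestDist ⟨k₁, hk₁⟩ fun k hk => ?_)⟩
  by_cases h : dist (y j) (y k) ≤ dist (y j) (y k₁)
  · exact hmin k ⟨hk, h⟩
  · exact hk₀d.trans (not_le.1 h).le

/-- `nn_j ≤ dist (y i) (y j) + nn_i` for all sites `i, j`. [folklore] -/
theorem nearestDist_le_dist_add (y : ι → X) (i j : ι) :
    nearestDist y j ≤ dist (y i) (y j) + nearestDist y i := by
  by_cases h : i = j
  · subst h
    simp
  · calc nearestDist y j ≤ dist (y j) (y i) := nearestDist_le_dist y h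
      _ = dist (y i) (y j) := dist_comm _ _
      _ ≤ dist (y i) (y j) + nearestDist y i := le_add_of_nonneg_right (nearestDist_nonneg y i)

/-! ### Sub-configurations `y ∘ f` along an injection `f : κ → ι` -/

-- adapted from `Cruxes.LocalToGlobal.Disproof.nearestDist_comp_eq` (embedding form)
/-- **Scale agreement.**  If a `y`-nearest neighbour of `f m` is in the range of the injection
`f`, the own scale of `m` in `y ∘ f` is the own scale of `f m` in `y`. [folklore] -/
theorem nearestDist_comp_eq_of_injective {y : ι → X} {f : κ → ι} (hf : Function.Injective f)
    {m m₀ : κ} (hm₀ : m₀ ≠ m) (h : nearestDist y (f m) = dist (y (f m)) (y (f m₀))) :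
    nearestDist (y ∘ f) m = nearestDist y (f m) := by
  apply le_antisymm
  · calc nearestDist (y ∘ f) m ≤ dist ((y ∘ f) m) ((y ∘ f) m₀) := nearestDist_le_dist (y ∘ f) hm₀
      _ = nearestDist y (f m) := by rw [h]; rfl
  · exact le_nearestDist ⟨m₀, hm₀⟩ fun k hk => nearestDist_le_dist y (hf.ne hk)

/-- **Bond agreement** given scale agreement at both endpoints. [folklore] -/
theorem adj_comp_iff {η : ℝ} {y : ι → X} {f : κ → ι} (hf : Function.Injective f) {m m' : κ}
    (hm : nearestDist (y ∘ f) m = nearestDist y (f m))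
    (hm' : nearestDist (y ∘ f) m' = nearestDist y (f m')) :
    (bondGraph η (y ∘ f)).Adj m m' ↔ (bondGraph η y).Adj (f m) (f m') := by
  simp only [bondGraph_adj, Function.comp_apply, hm, hm', hf.ne_iff]

/-- **Neighbour sets are preimages**: given scale agreement at `m` and at every site of the
sub-configuration within bond range `(1 + η)·nn` of `f m`, the neighbour set of `m` in `y ∘ f` is
the preimage under `f` of the neighbour set of `f m` in `y`. [folklore] -/
theorem neighborSet_comp_eq {η : ℝ} (hη : 0 ≤ 1 + η) {y : ι → X} {f : κ → ι}
    (hf : Function.Injective f) {m : κ} (hm : nearestDist (y ∘ f) m = nearestDist y (f m))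
    (hloc : ∀ k, dist (y (f m)) (y (f k)) ≤ (1 + η) * nearestDist y (f m) →
      nearestDist (y ∘ f) k = nearestDist y (f k)) :
    (bondGraph η (y ∘ f)).neighborSet m = f ⁻¹' (bondGraph η y).neighborSet (f m) := by
  ext m'
  rw [SimpleGraph.mem_neighborSet, Set.mem_preimage, SimpleGraph.mem_neighborSet]
  constructor
  · intro h
    have hd := dist_le_of_adj hη h
    rw [hm] at hd
    exact (adj_comp_iff hf hm (hloc m' hd)).1 h
  · intro h
    exact (adj_comp_iff hf hm (hloc m' (dist_le_of_adj hη h))).2 h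

/-- **Ring numbers agree** along a bond whose endpoints both satisfy the hypotheses of
`neighborSet_comp_eq`, if the neighbour set of `f m` lies in the range of `f`. [folklore] -/
theorem ringNumber_comp_eq {η : ℝ} (hη : 0 ≤ 1 + η) {y : ι → X} {f : κ → ι}
    (hf : Function.Injective f) {m m' : κ} (hm : nearestDist (y ∘ f) m = nearestDist y (f m))
    (hloc : ∀ k, dist (y (f m)) (y (f k)) ≤ (1 + η) * nearestDist y (f m) →
      nearestDist (y ∘ f) k = nearestDist y (f k))
    (hcov : (bondGraph η y).neighborSet (f m) ⊆ Set.range f)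
    (hm' : nearestDist (y ∘ f) m' = nearestDist y (f m'))
    (hloc' : ∀ k, dist (y (f m')) (y (f k)) ≤ (1 + η) * nearestDist y (f m') →
      nearestDist (y ∘ f) k = nearestDist y (f k)) :
    ringNumber η (y ∘ f) m m' = ringNumber η y (f m) (f m') := by
  rw [ringNumber_def, ringNumber_def, neighborSet_comp_eq hη hf hm hloc,
    neighborSet_comp_eq hη hf hm' hloc', ← Set.preimage_inter,
    Set.ncard_preimage_of_injective_subset_range hf (Set.inter_subset_left.trans hcov)]

/-- **Charge agreement.**  If the hypotheses of `neighborSet_comp_eq` hold at `m` and at every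
`m'` bonded to it, and the neighbour set of `f m` lies in the range of `f`, then `m` is charge-free
in `y ∘ f` iff `f m` is charge-free in `y`. [folklore] -/
theorem isChargeFree_comp_iff {η : ℝ} (hη : 0 ≤ 1 + η) {y : ι → X} {f : κ → ι}
    (hf : Function.Injective f) {m : κ} (hm : nearestDist (y ∘ f) m = nearestDist y (f m))
    (hloc : ∀ k, dist (y (f m)) (y (f k)) ≤ (1 + η) * nearestDist y (f m) →
      nearestDist (y ∘ f) k = nearestDist y (f k))
    (hcov : (bondGraph η y).neighborSet (f m) ⊆ Set.range f)
    (hN : ∀ m', f m' ∈ (bondGraph η y).neighborSet (f m) →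
      nearestDist (y ∘ f) m' = nearestDist y (f m') ∧
        ∀ k, dist (y (f m')) (y (f k)) ≤ (1 + η) * nearestDist y (f m') →
          nearestDist (y ∘ f) k = nearestDist y (f k)) :
    IsChargeFree η (y ∘ f) m ↔ IsChargeFree η y (f m) := by
  rw [isChargeFree_iff, isChargeFree_iff, neighborSet_comp_eq hη hf hm hloc,
    Set.ncard_preimage_of_injective_subset_range hf hcov]
  refine and_congr_right fun _ => ⟨fun H k hk => ?_, fun H m' hm' => ?_⟩
  · obtain ⟨m', rfl⟩ := hcov hk
    rw [← ringNumber_comp_eq hη hf hm hloc hcov (hN m' hk).1 (hN m' hk).2]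
    exact H m' hk
  · rw [Set.mem_preimage] at hm'
    rw [ringNumber_comp_eq hη hf hm hloc hcov (hN m' hm').1 (hN m' hm').2]
    exact H (f m') hm'

/-- **Scale agreement in a covering sub-configuration.**  If the range of the injection `f`
contains every site within `R` of `y i`, the configuration is locally finite about `y i`, and `i`
has another site, then the own scale of every `f m` with `2·dist (y i) (y (f m)) + nn_i ≤ R` is the
same in `y ∘ f` and in `y` (the minimiser of `f m` is within `dist (y i) (y (f m)) + nn_{f m}
≤ 2·dist (y i) (y (f m)) + nn_i` of `y i`). [folklore] -/
theorem nearestDist_comp_eq_of_cover {y : ι → X} {i : ι} {f : κ → ι} (hf : Function.Injective f)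
    {R : ℝ} (hcov : ∀ k, dist (y i) (y k) ≤ R → k ∈ Set.range f)
    (hfin : ∀ r : ℝ, {k | dist (y i) (y k) ≤ r}.Finite) (hi : ∃ k, k ≠ i) {m : κ}
    (hm : 2 * dist (y i) (y (f m)) + nearestDist y i ≤ R) :
    nearestDist (y ∘ f) m = nearestDist y (f m) := by
  have hj : ∃ k, k ≠ f m := by
    obtain ⟨k, hk⟩ := hi
    by_cases h : f m = i
    · exact ⟨k, fun hk' => hk (hk'.trans h)⟩
    · exact ⟨i, Ne.symm h⟩
  obtain ⟨k₀, hk₀, hnn⟩ :=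
    exists_nearestDist_eq_dist_of_finite (finite_ball_of_finite_ball hfin (f m)) hj
  have hk₀R : dist (y i) (y k₀) ≤ R := by
    have h1 := nearestDist_le_dist_add y i (f m)
    have h2 : dist (y i) (y k₀) ≤ dist (y i) (y (f m)) + dist (y (f m)) (y k₀) :=
      dist_triangle _ _ _
    rw [← hnn] at h2
    linarith
  obtain ⟨m₀, rfl⟩ := hcov k₀ hk₀R
  exact nearestDist_comp_eq_of_injective hf (fun h => hk₀ (congrArg f h)) hnn

end Locality

/-! ### The stub -/

/-- **Locally finite soft layer propagation.**  `SoftLayerPropagation` (stated in the route for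
`Fin N`-indexed configurations) implies the same conclusion at a site `i` of a configuration
`y : ι → ℝ³` with ANY index type, provided every ball about `y i` holds finitely many sites:
truncate to the `100·nn_i`-ball about `y i`, enumerate it by `Fin M`, observe that own scales
(within `49·nn_i`), bonds and neighbour sets (within `20·nn_i`) and charges (within `8·nn_i`) are
the same read in the truncation and in `y`, apply `SoftLayerPropagation` at `η = 1/100` to the
truncation, and transfer the two matching clauses back. [folklore] -/
theorem stub_softLayerPropagationLF : Summit.AtomisticToContinuum.Crystallization.Theses.PricedLinkCensus.SoftLayerPropagation → ∀ (ι : Type) (y : ι → EuclideanSpace ℝ (Fin 3)) (i : ι), (∀ r : ℝ, Set.Finite {j : ι | dist (y i) (y j) ≤ r}) → (∀ j : ι, dist (y i) (y j) ≤ 8 * Literature.Geometry.DiscreteGeometry.nearestDist y i → Literature.Geometry.DiscreteGeometry.IsChargeFree (1 / 100 : ℝ) y j) → ∃ (s : ℤ → ℤ) (g : EuclideanSpace ℝ (Fin 3) ≃ᵃⁱ[ℝ] EuclideanSpace ℝ (Fin 3)), Literature.MathematicalPhysics.StatisticalMechanics.IsHaggSeq s ∧ (∀ j : ι, dist (y i)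 (y j) ≤ 3 * Literature.Geometry.DiscreteGeometry.nearestDist y i → ∃ z ∈ Literature.MathematicalPhysics.StatisticalMechanics.barlowStacking (Literature.Geometry.DiscreteGeometry.nearestDist y i) (Literature.Geometry.DiscreteGeometry.nearestDist y i * Real.sqrt (2 / 3)) s, dist (y j) (g z) ≤ Literature.Geometry.DiscreteGeometry.nearestDist y i / 6) ∧ ∀ z ∈ Literature.MathematicalPhysics.StatisticalMechanics.barlowStacking (Literature.Geometry.DiscreteGeometry.nearestDist y i) (Literature.Geometry.DiscreteGeometry.nearestDist y i * Real.sqrt (2 / 3)) s, dist (y i) (g z) ≤ 3 * Literature.Geometry.DiscreteGeometry.nearestDist y i → ∃ j : ι, dist (y j) (g z) ≤ Literature.Geometry.DiscreteGeometry.nearestDist y i / 6 := by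
  intro hSLP ι y i hfin hcf
  have hnn0 : 0 ≤ nearestDist y i := nearestDist_nonneg y i
  -- `i` is charge-free, hence has a bond, hence another site
  have hi : ∃ k, k ≠ i := by
    have hci : IsChargeFree (1 / 100 : ℝ) y i :=
      hcf i (by rw [dist_self]; exact mul_nonneg (by norm_num) hnn0)
    have h0 : ((bondGraph (1 / 100 : ℝ) y).neighborSet i).ncard ≠ 0 := by rw [hci.1]; decide
    obtain ⟨k, hk⟩ := Set.nonempty_of_ncard_ne_zero h0
    exact ⟨k, (mem_neighborSet_bondGraph.1 hk).1.symm⟩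
  -- enumerate the `100·nn_i`-ball about `y i`
  haveI := (hfin (100 * nearestDist y i)).to_subtype
  obtain ⟨M, ⟨e⟩⟩ := Finite.exists_equiv_fin {k : ι | dist (y i) (y k) ≤ 100 * nearestDist y i}
  obtain ⟨f, hf, hcov⟩ : ∃ f : Fin M → ι, Function.Injective f ∧
      ∀ k, dist (y i) (y k) ≤ 100 * nearestDist y i → k ∈ Set.range f :=
    ⟨fun m => (e.symm m).1, fun a b h => e.symm.injective (Subtype.ext h),
      fun k hk => ⟨e ⟨k, hk⟩, by simp⟩⟩
  -- own scales agree within `49·nn_i`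
  have hscale : ∀ m : Fin M, dist (y i) (y (f m)) ≤ 49 * nearestDist y i →
      nearestDist (y ∘ f) m = nearestDist y (f m) := fun m hm =>
    nearestDist_comp_eq_of_cover hf hcov hfin hi (by linarith)
  -- bonds / neighbour sets agree within `20·nn_i`
  have hD : ∀ m : Fin M, dist (y i) (y (f m)) ≤ 20 * nearestDist y i →
      nearestDist (y ∘ f) m = nearestDist y (f m) ∧
        ∀ k, dist (y (f m)) (y (f k)) ≤ (1 + 1 / 100) * nearestDist y (f m) →
          nearestDist (y ∘ f) k = nearestDist y (f k) := by
    intro m hm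
    refine ⟨hscale m (by linarith), fun k hk => hscale k ?_⟩
    have h1 := nearestDist_le_dist_add y i (f m)
    have h2 := dist_triangle (y i) (y (f m)) (y (f k))
    linarith
  have hcovN : ∀ m : Fin M, dist (y i) (y (f m)) ≤ 20 * nearestDist y i →
      (bondGraph (1 / 100 : ℝ) y).neighborSet (f m) ⊆ Set.range f := by
    intro m hm k hk
    refine hcov k ?_
    have h1 := nearestDist_le_dist_add y i (f m)
    have h2 : dist (y (f m)) (y k) ≤ (1 + 1 / 100) * nearestDist y (f m) :=
      dist_le_of_adj (by norm_num) hk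
    have h3 := dist_triangle (y i) (y (f m)) (y k)
    linarith
  -- charges agree within `8·nn_i`
  have hcharge : ∀ m : Fin M, dist (y i) (y (f m)) ≤ 8 * nearestDist y i →
      (IsChargeFree (1 / 100 : ℝ) (y ∘ f) m ↔ IsChargeFree (1 / 100 : ℝ) y (f m)) := by
    intro m hm
    have h20 : dist (y i) (y (f m)) ≤ 20 * nearestDist y i := by linarith
    refine isChargeFree_comp_iff (by norm_num) hf (hD m h20).1 (hD m h20).2 (hcovN m h20)
      fun m' hm' => hD m' ?_
    have h1 := nearestDist_le_dist_add y i (f m)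
    have h2 : dist (y (f m)) (y (f m')) ≤ (1 + 1 / 100) * nearestDist y (f m) :=
      dist_le_of_adj (by norm_num) hm'
    have h3 := dist_triangle (y i) (y (f m)) (y (f m'))
    linarith
  -- the centre as a site of the truncation
  obtain ⟨i₀, rfl⟩ := hcov i (by rw [dist_self]; exact mul_nonneg (by norm_num) hnn0)
  have hnnF : nearestDist (y ∘ f) i₀ = nearestDist y (f i₀) :=
    hscale i₀ (by rw [dist_self]; exact mul_nonneg (by norm_num) hnn0)
  -- apply soft layer propagation to the truncation
  obtain ⟨s, g, hs, h1, h2⟩ := hSLP (1 / 100) (by norm_num) le_rfl M (y ∘ f) i₀ (by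
    intro m hm
    rw [hnnF] at hm
    exact (hcharge m hm).2 (hcf (f m) hm))
  rw [hnnF] at h1 h2
  refine ⟨s, g, hs, fun j hj => ?_, fun z hz hzd => ?_⟩
  · obtain ⟨m, rfl⟩ := hcov j (by linarith)
    exact h1 m hj
  · obtain ⟨m, hm⟩ := h2 z hz hzd
    exact ⟨f m, hm⟩

end Summit.AtomisticToContinuum.Crystallization.Theorems.PricedHcpWindowsLocallyFinite
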